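import Literature.AlgebraicGeometry.Resolution.StrictTransformFiniteFlatteningQcqs
import Literature.AlgebraicGeometry.Resolution.SeparatingBlowup
import Literature.RingTheory.FittingIdeal.FinitePresentation
import Mathlib.RingTheory.Finiteness.ModuleFinitePresentation
import HarnessLib

/-!
# The admissible centre for flattening a finite, finitely presented morphism of constant rank
(Stacks 081R / 0811 for finite morphisms: from the hypotheses on `U` to the centre)

Topic: `Literature/AlgebraicGeometry/Resolution`. Let `S` be quasi-compact and quasi-separated,
`f : X → S` finite and locally of finite presentation, `U ⊆ S` a quasi-compact open over which
`X` is finite locally free of constant rank `r` — in terms of the Fitting ideal sheaves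
(`Scheme.Hom.fittingIdealSheaf`; Stacks 07ZD): `Fit_r(f_*𝒪_X)|_U = 𝒪_U` and
`Fit_k(f_*𝒪_X)|_U = 0` for `k < r`. Then there is an ideal sheaf of finite type `𝓚` with
`V(𝓚) = S ∖ U` (Stacks 01PI), `𝓚ᵐ ⊆ Fit_r` and `𝓚ⁿ Fit_k = 0` for `k < r` (finite type +
quasi-compactness), and `Fit_r` is of finite type (Stacks 07ZA (4)). Feeding this to
`exists_isBlowup_flat_lfp_blowupStrictTransformMap_of_isFinite_of_fittingIdealSheaf`
(`StrictTransformFiniteFlatteningQcqs.lean`) gives the conclusion of `Stacks081R` verbatim for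
such `f` (`exists_isBlowup_flat_lfp_of_isFinite_of_fittingRank`).

* `fg_ideal_fittingIdealSheaf` — `Fit_k(f_*𝒪_X)` is of finite type for `f` finite and locally of
  finite presentation;
* `exists_pow_le_of_le_radical` — `𝓚 ⊆ √𝓕`, `𝓚` of finite type, `X` quasi-compact ⇒ `𝓚ᵐ ⊆ 𝓕`;
* `exists_pow_mul_eq_bot_of_forall_ideal_eq_bot` — `𝓕|_{X ∖ V(𝓚)} = 0`, both of finite type,
  `X` quasi-compact ⇒ `𝓚ⁿ 𝓕 = 0`;
* `exists_admissible_centre_of_fittingRank` — the centre;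
* `exists_isBlowup_flat_lfp_of_isFinite_of_fittingRank` — **Stacks 081R for finite, finitely
  presented `f` of constant rank `r` over `U`.**

## References

* The Stacks Project, Tags 081R, 0811, 01PI, 07ZA, 07ZD. [StacksProject]
* M. Raynaud, L. Gruson, *Critères de platitude et de projectivité*, Invent. Math. 13 (1971),
  Première partie, 5.2. [RaynaudGruson1971]
-/

noncomputable section

open CategoryTheory CategoryTheory.Limits AlgebraicGeometry TopologicalSpace

namespace Literature.AlgebraicGeometry.Resolution

universe u

open Literature.RingTheory.FittingIdeal Literature.AlgebraicGeometry.Limits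
  Literature.AlgebraicGeometry.Morphisms

/-! ## Finite type of the Fitting ideal sheaves -/

/-- For `f` finite and locally of finite presentation, the Fitting ideal sheaves `Fit_k(f_*𝒪_X)`
are of finite type: `Γ(X, f⁻¹W)` is a finitely presented `Γ(S, W)`-module (Stacks 0564) and
Fitting ideals of finitely presented modules are finitely generated (Stacks 07ZA (4)).
[cite: StacksProject, Tag 07ZA] -/
theorem fg_ideal_fittingIdealSheaf {X S : Scheme.{u}} (f : X ⟶ S) [IsFinite f]
    [LocallyOfFinitePresentation f] (k : ℕ) (W : S.affineOpens) :
    ((f.fittingIdealSheaf k).ideal W).FG := by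
  rw [fittingIdealSheaf_ideal]
  letI alg : Algebra Γ(S, W) Γ(X, f ⁻¹ᵁ (W : S.Opens)) := (f.app (W : S.Opens)).hom.toAlgebra
  haveI : Module.Finite Γ(S, W) Γ(X, f ⁻¹ᵁ (W : S.Opens)) := finite_app_of_isFinite f W
  haveI : Algebra.FinitePresentation Γ(S, W) Γ(X, f ⁻¹ᵁ (W : S.Opens)) := by
    have h := f.finitePresentation_appLE W.2 (W.2.preimage f) le_rfl
    rw [← Scheme.Hom.app_eq_appLE] at h
    exact h
  haveI : Module.FinitePresentation Γ(S, W) Γ(X, f ⁻¹ᵁ (W : S.Opens)) :=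
    Module.FinitePresentation.of_finite_of_finitePresentation _ _
  exact Module.fittingIdeal_fg k

/-! ## Powers of finite type ideal sheaves on quasi-compact schemes -/

section Powers

variable {X : Scheme.{u}} [CompactSpace X]

omit [CompactSpace X] in
/-- The covering affine opens of `exists_finset_affineOpens_iSup_eq_top` as an indexed cover.
[folklore] -/
theorem le_iSup_of_iSup_eq_top {s : Finset X.affineOpens}
    (hs : ⊤ ≤ ⨆ V ∈ s, (V : X.Opens)) (W : X.affineOpens) :
    (W : X.Opens) ≤ ⨆ V : s, ((V : X.affineOpens) : X.Opens) :=
  le_top.trans (hs.trans (iSup₂_le fun V hV =>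
    le_iSup (fun V : s => ((V : X.affineOpens) : X.Opens)) ⟨V, hV⟩))

/-- **`𝓚 ⊆ √𝓕` with `𝓚` of finite type on a quasi-compact scheme ⇒ `𝓚ᵐ ⊆ 𝓕`** (affine-locally
`Ideal.exists_pow_le_of_le_radical_of_fg`, a uniform exponent over a finite affine cover, and
locality of inequalities of ideal sheaves). [folklore] -/
theorem exists_pow_le_of_le_radical (K F : X.IdealSheafData)
    (hK : ∀ W : X.affineOpens, (K.ideal W).FG) (h : K ≤ F.radical) : ∃ m : ℕ, K ^ m ≤ F := by
  classical
  obtain ⟨s, hs⟩ := Limits.exists_finset_affineOpens_iSup_eq_top X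
  have hloc : ∀ W : X.affineOpens, ∃ m : ℕ, K.ideal W ^ m ≤ F.ideal W := fun W =>
    Ideal.exists_pow_le_of_le_radical_of_fg (h W) (hK W)
  choose m hm using hloc
  refine ⟨s.sup m, fun W => ?_⟩
  refine Limits.ideal_le_ideal_of_le_iSup (K ^ s.sup m) F
    (fun V : s => ((V : X.affineOpens) : X.Opens)) (fun V A hA => ?_) W (le_iSup_of_iSup_eq_top hs W)
  have hle : m (V : X.affineOpens) ≤ s.sup m := Finset.le_sup V.2
  rw [Scheme.IdealSheafData.ideal_pow, Pi.pow_apply,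
    ← Scheme.IdealSheafData.map_ideal (I := K) (show A ≤ (V : X.affineOpens) from hA),
    ← Scheme.IdealSheafData.map_ideal (I := F) (show A ≤ (V : X.affineOpens) from hA),
    ← Ideal.map_pow]
  exact Ideal.map_mono ((Ideal.pow_le_pow_right hle).trans (hm V))

/-- **`𝓕` vanishing off `V(𝓚)`, both of finite type, on a quasi-compact scheme ⇒ `𝓚ⁿ 𝓕 = 0`**:
affine-locally, for `g ∈ 𝓚(V)` we have `D(g) ⊆ X ∖ V(𝓚)`, so `𝓕(V)[1/g] = 𝓕(D(g)) = 0` and a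
power of `g` kills each generator of `𝓕(V)`; hence `𝓚(V) ⊆ √Ann(𝓕(V))`, a power of the finitely
generated `𝓚(V)` kills `𝓕(V)`, and a uniform exponent over a finite affine cover works globally.
[folklore] -/
theorem exists_pow_mul_eq_bot_of_forall_ideal_eq_bot (K F : X.IdealSheafData)
    (hK : ∀ W : X.affineOpens, (K.ideal W).FG) (hF : ∀ W : X.affineOpens, (F.ideal W).FG)
    (h : ∀ W : X.affineOpens, (W : X.Opens) ≤ centreCompl K → F.ideal W = ⊥) :
    ∃ n : ℕ, K ^ n * F = ⊥ := by
  classical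
  obtain ⟨s, hs⟩ := Limits.exists_finset_affineOpens_iSup_eq_top X
  -- affine-locally: `𝓚(V) ⊆ √Ann(𝓕(V))`
  have hloc : ∀ V : X.affineOpens, ∃ n : ℕ, K.ideal V ^ n * F.ideal V = ⊥ := fun V => by
    have hrad : K.ideal V ≤ ((F.ideal V).annihilator).radical := fun g hg => by
      -- `D(g) ⊆ X ∖ V(𝓚)`, so `𝓕(D(g)) = 0`
      have hDg : (X.affineBasicOpen g : X.Opens) ≤ centreCompl K := fun p hp hps => by
        have hpV : p ∈ (V : X.Opens) := X.basicOpen_le g hp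
        rw [SetLike.mem_coe, Scheme.IdealSheafData.mem_support_iff_of_mem hpV,
          Scheme.mem_zeroLocus_iff] at hps
        exact hps g hg hp
      have hFg : (F.ideal V).map (X.presheaf.map (homOfLE (X.basicOpen_le g)).op).hom = ⊥ := by
        rw [F.map_ideal_basicOpen V g]
        exact h _ hDg
      haveI := V.2.isLocalization_basicOpen g
      -- each generator of `𝓕(V)` is killed by a power of `g`
      obtain ⟨t, ht⟩ := hF V
      have hkill : ∀ x ∈ t, ∃ n : ℕ, g ^ n * x = 0 := fun x hx => by
        have hx0 : algebraMap Γ(X, V) Γ(X, X.basicOpen g) x = 0 := by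
          rw [← Ideal.mem_bot, ← hFg]
          exact Ideal.mem_map_of_mem _ (ht ▸ Ideal.subset_span hx)
        obtain ⟨⟨_, n, rfl⟩, hn⟩ := (IsLocalization.map_eq_zero_iff (Submonoid.powers g) _ x).mp hx0
        exact ⟨n, hn⟩
      choose! n hn using hkill
      refine ⟨t.sup n, Submodule.mem_annihilator.mpr fun x hx => ?_⟩
      rw [← ht] at hx
      refine Submodule.span_induction (fun y hy => ?_) (by simp) (fun y z _ _ hy hz => ?_)
        (fun a y _ hy => ?_) hx
      · show g ^ t.sup n * y = 0
        rw [← Nat.sub_add_cancel (Finset.le_sup (f := n) hy), pow_add, mul_assoc, hn y hy, mul_zero]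
      · rw [smul_add, hy, hz, add_zero]
      · rw [smul_comm, hy, smul_zero]
    obtain ⟨n, hn⟩ := Ideal.exists_pow_le_of_le_radical_of_fg hrad (hK V)
    exact ⟨n, le_bot_iff.mp ((Ideal.mul_mono_left hn).trans (Submodule.annihilator_mul _).le)⟩
  choose n hn using hloc
  refine ⟨s.sup n, le_bot_iff.mp fun W => ?_⟩
  refine Limits.ideal_le_ideal_of_le_iSup (K ^ s.sup n * F) ⊥
    (fun V : s => ((V : X.affineOpens) : X.Opens)) (fun V A hA => ?_) W (le_iSup_of_iSup_eq_top hs W)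
  have hle : n (V : X.affineOpens) ≤ s.sup n := Finset.le_sup V.2
  have hV : K.ideal (V : X.affineOpens) ^ s.sup n * F.ideal (V : X.affineOpens) = ⊥ :=
    le_bot_iff.mp ((Ideal.mul_mono_left (Ideal.pow_le_pow_right hle)).trans (hn V).le)
  rw [Scheme.IdealSheafData.ideal_mul, Pi.mul_apply, Scheme.IdealSheafData.ideal_pow, Pi.pow_apply,
    ← Scheme.IdealSheafData.map_ideal (I := K) (show A ≤ (V : X.affineOpens) from hA),
    ← Scheme.IdealSheafData.map_ideal (I := F) (show A ≤ (V : X.affineOpens) from hA),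
    ← Ideal.map_pow, ← Ideal.map_mul, hV, Ideal.map_bot]
  exact bot_le

end Powers

/-! ## The centre -/

section Centre

variable {X S : Scheme.{u}} (f : X ⟶ S) [IsFinite f] [LocallyOfFinitePresentation f]
  [CompactSpace S] [QuasiSeparatedSpace S]

omit [QuasiSeparatedSpace S] in
/-- **Any finite type `𝓚` with `V(𝓚) = S ∖ U` is an admissible multiplier.** For `f` finite,
locally of finite presentation, `S` quasi-compact, `U ⊆ S` an open over which `X` is finite
locally free of constant rank `r` (`Fit_r(f_*𝒪_X)|_U = 𝒪_U`, `Fit_k(f_*𝒪_X)|_U = 0` for `k < r`)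
and `𝓚` an ideal sheaf of finite type with `V(𝓚) = S ∖ U`: `𝓚ᵐ ⊆ Fit_r` and `𝓚ⁿ Fit_k = 0` for
`k < r`. [cite: StacksProject, Tag 0811 (proof); RaynaudGruson1971, Première partie 5.2] -/
theorem pow_le_and_pow_mul_eq_bot_of_support_eq (U : S.Opens) (r : ℕ)
    (hr : ∀ W : S.affineOpens, (W : S.Opens) ≤ U →
      (f.fittingIdealSheaf r).ideal W = ⊤ ∧ ∀ k < r, (f.fittingIdealSheaf k).ideal W = ⊥)
    (K : S.IdealSheafData) (hKfg : ∀ W : S.affineOpens, (K.ideal W).FG)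
    (hKsupp : (K.support : Set S) = (U : Set S)ᶜ) :
    (∃ m : ℕ, K ^ m ≤ f.fittingIdealSheaf r) ∧
      ∀ k < r, ∃ n : ℕ, K ^ n * f.fittingIdealSheaf k = ⊥ := by
  have hKU : centreCompl K = U := centreCompl_eq_of_support_eq hKsupp
  refine ⟨?_, fun k hk => ?_⟩
  · -- `V(Fit_r) ⊆ S ∖ U = V(𝓚)`, so `𝓚 ⊆ √Fit_r`
    refine exists_pow_le_of_le_radical K _ hKfg ?_
    rw [← Scheme.IdealSheafData.vanishingIdeal_support]
    refine Scheme.IdealSheafData.le_support_iff_le_vanishingIdeal.mp fun p hp => ?_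
    -- a point of `V(Fit_r)` is not in `U`
    change p ∈ (K.support : Set S)
    rw [hKsupp]
    intro hpU
    obtain ⟨W, hW, hpW, hWU⟩ := exists_isAffineOpen_mem_and_subset (X := S) (x := p) (U := U) hpU
    have h1 := (hr ⟨W, hW⟩ hWU).1
    rw [Scheme.IdealSheafData.mem_support_iff_of_mem (U := ⟨W, hW⟩) hpW,
      Scheme.mem_zeroLocus_iff] at hp
    exact hp 1 (h1 ▸ Submodule.mem_top) (by rw [Scheme.basicOpen_one]; exact hpW)
  · exact exists_pow_mul_eq_bot_of_forall_ideal_eq_bot K _ hKfg (fg_ideal_fittingIdealSheaf f k)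
      fun W hW => (hr W (hKU ▸ hW)).2 k hk

/-- **The admissible centre.** For `f` finite, locally of finite presentation, `S` qcqs and a
quasi-compact open `U ⊆ S` over which `X` is finite locally free of constant rank `r`
(`Fit_r(f_*𝒪_X)|_U = 𝒪_U`, `Fit_k(f_*𝒪_X)|_U = 0` for `k < r`): there is a finite type ideal
sheaf `𝓚` with `V(𝓚) = S ∖ U`, `𝓚ᵐ ⊆ Fit_r` and `𝓚ⁿ Fit_k = 0` for `k < r`.
[cite: StacksProject, Tag 0811 (proof); RaynaudGruson1971, Première partie 5.2] -/
theorem exists_admissible_centre_of_fittingRank (U : S.Opens) (hU : IsCompact (U : Set S))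
    (r : ℕ) (hr : ∀ W : S.affineOpens, (W : S.Opens) ≤ U →
      (f.fittingIdealSheaf r).ideal W = ⊤ ∧ ∀ k < r, (f.fittingIdealSheaf k).ideal W = ⊥) :
    ∃ K : S.IdealSheafData, (∀ W : S.affineOpens, (K.ideal W).FG) ∧
      (K.support : Set S) = (U : Set S)ᶜ ∧ (∃ m : ℕ, K ^ m ≤ f.fittingIdealSheaf r) ∧
      ∀ k < r, ∃ n : ℕ, K ^ n * f.fittingIdealSheaf k = ⊥ := by
  obtain ⟨K, hKfg, hKsupp⟩ := exists_fg_support_eq_compl U hU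
  exact ⟨K, hKfg, hKsupp, pow_le_and_pow_mul_eq_bot_of_support_eq f U r hr K hKfg hKsupp⟩

/-- **Stacks 081R for finite, finitely presented morphisms of constant rank `r` over `U`.**
Let `S` be quasi-compact and quasi-separated, `f : X → S` finite and locally of finite
presentation, `U ⊆ S` a quasi-compact open over which `X` is finite locally free of constant
rank `r` (`Fit_r(f_*𝒪_X)|_U = 𝒪_U` and `Fit_k(f_*𝒪_X)|_U = 0` for `k < r`, Stacks 07ZD). Then
there is a `U`-admissible blowing up `b : S' → S` — the blowing up in a finite type ideal sheaf
`𝓘` with `V(𝓘) ∩ U = ∅` — such that the strict transform of `X` is flat and locally of finite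
presentation over `S'`: the conclusion of `Stacks081R`, verbatim, for such `f`.
[cite: StacksProject, Tag 081R; RaynaudGruson1971, Première partie Thm. 5.2.2] -/
theorem exists_isBlowup_flat_lfp_of_isFinite_of_fittingRank (U : S.Opens)
    (hU : IsCompact (U : Set S)) (r : ℕ) (hr : ∀ W : S.affineOpens, (W : S.Opens) ≤ U →
      (f.fittingIdealSheaf r).ideal W = ⊤ ∧ ∀ k < r, (f.fittingIdealSheaf k).ideal W = ⊥) :
    ∃ (I : S.IdealSheafData) (S' : Scheme.{u}) (b : S' ⟶ S),
      (∀ W : S.affineOpens, (I.ideal W).FG) ∧ Disjoint (U : Set S) (I.support : Set S) ∧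
      IsBlowup b I ∧ Flat (blowupStrictTransformMap f b I) ∧
      LocallyOfFinitePresentation (blowupStrictTransformMap f b I) := by
  obtain ⟨K, hKfg, hKsupp, hKF, hrank⟩ := exists_admissible_centre_of_fittingRank f U hU r hr
  obtain ⟨S', b, hfg, hdisj, hb, hflat, hlfp⟩ :=
    exists_isBlowup_flat_lfp_blowupStrictTransformMap_of_isFinite_of_fittingIdealSheaf f K hKF hrank
      hKfg (fg_ideal_fittingIdealSheaf f r)
  refine ⟨K * f.fittingIdealSheaf r, S', b, hfg, ?_, hb, hflat, hlfp⟩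
  rwa [centreCompl_eq_of_support_eq hKsupp] at hdisj

end Centre

end Literature.AlgebraicGeometry.Resolution

end
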